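import Summits.ValiantsHypothesis.ValiantsHypothesis.Theorems.KPlusLogSqLawTropicalBSquareDoubling

set_option linter.dupNamespace false
set_option autoImplicit false

/-! ## Route «KPlusLogSqLaw» (route-ValiantsHypothesis-KPlusLogSqLaw): THIRD LINE «square-doubling» on crux `TropicalB` = item stmt-ValiantsHypothesis-19771
## (crux-workfile `Cruxes/TropicalB/Lines/square-doubling.lean`; custody #2 conjb-2 g9, 2026-08-26; desk rulings R1571 (β′) / R1573 / R1580,
## director-valiant 2026-08-26 l.7282; route text UNCHANGED rev 8 f0fe62816c62)

HONEST FRAMING.  A proof SKELETON over an OPEN conjecture of the object-search cell `pub-symmetroid`: the two `stub_*` below are `sorry` and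
are NOT claimed; nothing in this file asserts `TropicalB`, the square tower, any doubling law, `WeakLifting`, `KPlusLogSqLaw` (B),
`MatrixDescartes` (stmt-ValiantsHypothesis-18050) or anything about VP ≠ VNP.  This is a LINE on the crux, not a re-cut of the registered birth
skeleton `Lines/birth.lean` (v2, c154994ecbb5076f: `stub_tropThin` / `stub_tropFat` / `stub_tropStaticDiagonal` / `stub_tropTowerLog`) nor of
the second line `Lines/doubling.lean` (bd0c03eb908e533e: `stub_signedDoubling`), and not a route revision.

THE LINE — the first TWO-PIECE cut of `TropicalB` in which NEITHER piece is a known equivalent of the crux (source: conjb-2 g8 memo ROUND1f §1–§2;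
kernel compositions landed as `Theorems/KPlusLogSqLawTropicalBSquareDoubling.lean`, p470108, namespace `…Theorems.KPlusLogSqLaw.SquareDoubling`):

* `stub_squareTower` — the SQUARE TOWER `T(K², K) ≤ 2^{C K}` for all `K` (O(1) bits per slope class at row budget `m = K²`); stated verbatim as
  the body of `SquareDoubling.SquareTower` (so `stub_squareTower : SquareDoubling.SquareTower` elaborates by `Iff.rfl`/δ).  BELOW the crux:
  `squareTower_of_tropicalB` (trop-p5, `…TropicalBShadowCap`, not imported here to stay lint-clean — `lint.theses-cone`); converse UNKNOWN
  (REGIME-COLLAPSE R3: the towers `m = K·g(K)` are a genuine hierarchy under the tree's paddings).  It IMPLIES the birth foothold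
  `stub_tropTowerLog` by monotonicity in `m` (`K·⌊log₂ K⌋ ≤ K²`, `tropRootLawAt_of_le`), so TowerLog becomes a corollary target of this piece.
* `stub_doublingFromSq` — the SIGNED BALANCED DOUBLING LAW FROM SIZE `K²` ON: some exponent `c` works for every `K` and every balanced split
  `a + e` with `K² ≤ a ≤ e ≤ a + 1`: `TropRootLawAt a K B₁ → TropRootLawAt e K B₂ → TropRootLawAt (a+e) K ((a+e)^c · (B₁ + B₂ + 2))`
  (= `SquareDoubling.DoublingFrom (fun K => K ^ 2) c`).  WEAKER than the registered `stub_signedDoubling` (threshold `K`):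
  `SquareDoubling.doublingSq_of_doublingId`.  With a COUNTING base it reaches only `2^{O(K log K)}·m^{O(log m)}` (TowerLog strength), not the crux.
* `TropicalB_skeleton_sq : TropicalB` — the crux BY NAME from the two stubs, via the landed kernel composition
  `SquareDoubling.tropicalB_of_squareTower_of_doublingSq` (dyadic induction from threshold `K²`, base = square tower at `2K` + size/class padding;
  `C = 2C₀ + 6(c+2)`).  `TropicalB_of_squareTower_of_doublingFromSq` records the same composition with the stubs as explicit hypotheses,
  concluding the UNFOLDED crux (so that the hypothesis-free theorem is the only declaration of this file whose conclusion head is `TropicalB` —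
  `#h21_check_skeleton` shape, ONBOARD §0).

WHY A SPLIT AND NOT A DRESS (BC2 (a)–(d) reading, located not claimed): (a) two load-bearing pieces; (b) the assembly is PROVED (p470108);
(c) neither piece gives the crux alone as far as the tree knows — SquareTower ⇐ TB with converse unknown; the `K²`-law alone is TowerLog-strength;
(d) plans per piece: SquareTower ← trop-p5's shadow cap (`squareTower_of_shadowQuasiPolyCap`; Hessenberg sector done: `…TropicalBHessenbergSquareTower`);
`K²`-law ← trop-p2 R21 halves localisation (`Halves.halves_subadditive`, p457167: bound the distinct half-terms of ONE alternating chain at ONE balanced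
cut by `m^c` × the half-size capacities; sector tools OdometerLocality / ShortSteps / BlockOrder eras / ConvexPosition.sidon).

HOW IT DIES (honest risk, verbatim from R1571 (4)(a)): the `K²`-law still forbids exponential-in-`K` jumps between consecutive sizes ABOVE `m = K²`
that `TropicalB` (budget `2^{CK}` in the fat corner) permits; it is GENUINELY STRONGER than the crux there.  Its kill test is STRUCTURAL ONLY: the
first pair not settled by counting needs `c < K − 3`, e.g. `K = 5`, `(50,5)` vs `(25,5)` (counting `T(50,5) ≤ C(54,4) − 1 = 316250`; padding
`T(25,5) ≥ C(27,2) − 1 = 350`; the law with `c = 1` needs `T(50,5) ≤ 50·(2·350 + 2) = 35100`) — NOT census-computable; killable only by a family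
that keeps `T(a,K) ≪ 2^{CK}` up to some `a ≥ K²` and then jumps (no such family in the tree or in print).  The square tower dies iff some family has
`log₂ T(K²,K) = ω(K)` — which would also kill the crux (`squareTower_of_tropicalB`), so that death is informative about TB itself.

STUB CEILING (director, R1573): with these two the active stubs on 19771 number 7 = the ceiling; if an eighth is ever proposed, the retire-candidate
named by this card is `stub_tropTowerLog` (implied by `stub_squareTower` by monotonicity in `m`).

REGISTRATION NOTE (mechanics, R1571 (2)): `ledger skeleton check <file> --crux stmt-ValiantsHypothesis-19771` REPLACES the item's registered stub set;
running it on THIS file alone would expire the five registered stubs.  Register the two stubs ADDITIVELY (`ledger workitem stub-add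
stmt-ValiantsHypothesis-19771 --name stub_squareTower --signature '…'`, same for `stub_doublingFromSq`) — never by a bare skeleton check of this file.
Sorries: exactly two (`stub_squareTower`, `stub_doublingFromSq`). -/

namespace Summit.ValiantsHypothesis.ValiantsHypothesis.Theses.KPlusLogSqLaw

open Summit.ValiantsHypothesis.ValiantsHypothesis.Theorems.LacunarySymmetroidMatrixDescartes.TropicalCensus
open Summit.ValiantsHypothesis.ValiantsHypothesis.Theorems.KPlusLogSqLaw

/-- **PIECE 1 — the SQUARE TOWER** (trop-p5 / desk docket D1a; verbatim the body of `SquareDoubling.SquareTower`): `T(K², K) ≤ 2^{CK}` for all `K`.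
BELOW the crux (`squareTower_of_tropicalB`), converse unknown; implies `stub_tropTowerLog` by monotonicity in `m`.  Plausibly ≥ L-sized; NOT claimed.
Plan: shadow cap (`squareTower_of_shadowQuasiPolyCap`).  Dies iff some family has `log₂ T(K²,K) = ω(K)` (which kills TB too). -/
theorem stub_squareTower :
    ∃ C : ℕ, ∀ K : ℕ, TropRootLawAt (K ^ 2) K (2 ^ (C * K)) := by
  sorry

/-- **PIECE 2 — the SIGNED BALANCED DOUBLING LAW FROM SIZE `K²` ON** (conjb-2 g8 ROUND1f §1; = `SquareDoubling.DoublingFrom (fun K => K ^ 2) c`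
for some `c`; weaker than the registered `stub_signedDoubling` by `SquareDoubling.doublingSq_of_doublingId`).  Plausibly ≥ L-sized; with a counting
base only TowerLog-strength, so NOT known to give the crux alone; NOT claimed.  Plan: halves localisation (`Halves.halves_subadditive`).  Risk: it
forbids exponential-in-`K` consecutive jumps above `m = K²` that TB permits; kill test structural only (`(50,5)` vs `(25,5)` is not census-computable). -/
theorem stub_doublingFromSq :
    ∃ c : ℕ, ∀ (K a e B₁ B₂ : ℕ), K ^ 2 ≤ a → a ≤ e → e ≤ a + 1 → TropRootLawAt a K B₁ → TropRootLawAt e K B₂ →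
      TropRootLawAt (a + e) K ((a + e) ^ c * (B₁ + B₂ + 2)) := by
  sorry

/-- bookkeeping: piece 1 IS `SquareDoubling.SquareTower` (δ). -/
theorem squareTower_iff_stub :
    SquareDoubling.SquareTower ↔ ∃ C : ℕ, ∀ K : ℕ, TropRootLawAt (K ^ 2) K (2 ^ (C * K)) := Iff.rfl

/-- bookkeeping: piece 2 IS `∃ c, SquareDoubling.DoublingFrom (fun K => K ^ 2) c` (δ). -/
theorem doublingFromSq_iff_stub :
    (∃ c : ℕ, SquareDoubling.DoublingFrom (fun K => K ^ 2) c) ↔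
      ∃ c : ℕ, ∀ (K a e B₁ B₂ : ℕ), K ^ 2 ≤ a → a ≤ e → e ≤ a + 1 → TropRootLawAt a K B₁ → TropRootLawAt e K B₂ →
        TropRootLawAt (a + e) K ((a + e) ^ c * (B₁ + B₂ + 2)) := Iff.rfl

/-- composition with the two stubs as explicit hypotheses, concluding the UNFOLDED crux (head `∃`, so that `TropicalB_skeleton_sq` is the unique
theorem of this file concluding `TropicalB` by name): the landed `SquareDoubling.tropicalB_of_squareTower_of_doublingSq` (p470108), `C = 2C₀ + 6(c+2)`. -/
theorem TropicalB_of_squareTower_of_doublingFromSq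
    (h₁ : ∃ C : ℕ, ∀ K : ℕ, TropRootLawAt (K ^ 2) K (2 ^ (C * K)))
    (h₂ : ∃ c : ℕ, ∀ (K a e B₁ B₂ : ℕ), K ^ 2 ≤ a → a ≤ e → e ≤ a + 1 → TropRootLawAt a K B₁ → TropRootLawAt e K B₂ →
      TropRootLawAt (a + e) K ((a + e) ^ c * (B₁ + B₂ + 2))) :
    ∃ C : ℕ, ∀ m K : ℕ, TropRootLawAt m K (2 ^ (C * (K + Nat.log 2 m ^ 2))) := by
  obtain ⟨c, hD⟩ := h₂
  exact SquareDoubling.tropicalB_of_squareTower_of_doublingSq (c := c) h₁ hD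

/-- SKELETON THEOREM (hypothesis-free; the stubs enter BY NAME): the crux `TropicalB` from `stub_squareTower` and `stub_doublingFromSq`. -/
theorem TropicalB_skeleton_sq : TropicalB := TropicalB_of_squareTower_of_doublingFromSq stub_squareTower stub_doublingFromSq

/-- for the record (R1571 (4)(b)): piece 1 implies the birth foothold `stub_tropTowerLog`'s statement by monotonicity in `m`
(`K·⌊log₂ K⌋ ≤ K²`, size padding `tropRootLawAt_of_le` of `…TropicalBPadding`) — TowerLog is a corollary target of this line, not a rival. -/
theorem tropTowerLog_of_squareTower (h : ∃ C : ℕ, ∀ K : ℕ, TropRootLawAt (K ^ 2) K (2 ^ (C * K))) :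
    ∃ C : ℕ, ∀ K : ℕ, TropRootLawAt (K * Nat.log 2 K) K (2 ^ (C * K)) := by
  obtain ⟨C, hC⟩ := h
  refine ⟨C, fun K => ?_⟩
  have hle : K * Nat.log 2 K ≤ K ^ 2 := by
    rw [sq]; exact Nat.mul_le_mul_left K (Nat.log_le_self 2 K)
  exact tropRootLawAt_of_le hle le_rfl (hC K)

/-- for the record (R1571 (4)(b)): the registered `stub_signedDoubling` (threshold `K`) implies piece 2 (threshold `K²`) —
`SquareDoubling.doublingSq_of_doublingId`. -/
theorem doublingFromSq_of_signedDoubling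
    (h : ∃ c : ℕ, ∀ (K a e B₁ B₂ : ℕ), K ≤ a → a ≤ e → e ≤ a + 1 → TropRootLawAt a K B₁ → TropRootLawAt e K B₂ →
      TropRootLawAt (a + e) K ((a + e) ^ c * (B₁ + B₂ + 2))) :
    ∃ c : ℕ, ∀ (K a e B₁ B₂ : ℕ), K ^ 2 ≤ a → a ≤ e → e ≤ a + 1 → TropRootLawAt a K B₁ → TropRootLawAt e K B₂ →
      TropRootLawAt (a + e) K ((a + e) ^ c * (B₁ + B₂ + 2)) := by
  obtain ⟨c, hc⟩ := h
  exact ⟨c, SquareDoubling.doublingSq_of_doublingId ((SquareDoubling.doublingFrom_id_iff c).mpr hc)⟩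

end Summit.ValiantsHypothesis.ValiantsHypothesis.Theses.KPlusLogSqLaw
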